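import Literature.Topology.FourManifolds.SPC4HandlesThmALift
import Literature.Topology.FourManifolds.SPC4HandlesOrientationReversingHolds
import Literature.Topology.FourManifolds.SPC4HandlesGeneratingSets
import Literature.Topology.FourManifolds.SPC4HandlesThmAImpliesCerf
import HarnessLib

/-!
# Laudenbach–Poénaru's extension theorem after the `1`-handle lemma: two leaves remain

Topic `Literature/Topology/FourManifolds`; review seat of the named fact
`Literature.Topology.FourManifolds.exists_diffeomorph_comp_incl_eq` (**spc4.S24 (c)**,
`SPC4Handles.lean`: every self-diffeomorphism of the boundary `#k S¹ × S²` of a compact connected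
orientable smooth `4`-dimensional `1`-handlebody `V ≅ ♮k S¹ × B³` extends over `V`;
Laudenbach–Poénaru, Bull. SMF 100 (1972), Thm. A and its proof, §2, pp. 341–342, in the extension
form quoted by Kirby (1989), Ch. I §2, p. 8 and Gompf–Stipsicz (1999), §4.4).  Everything here is
**proved**; no definition and no named fact is introduced, and one named fact of the DAG is
discharged (UNIQ₄).

The tree proves the fact from the five `1`-handlebody facts h₁–h₅ of `SPC4HandlesProofs.lean`
(`exists_diffeomorph_comp_incl_eq_of_laudenbachPoenaru`), of which the collar fact h₄
(`BoundaryData.diffeoExtends_of_isDiffeotopicToId_holds`, `CollarTheorem.lean`), the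
connectedness of the boundary h₅ (`connectedSpace_boundary_of_isHandlebodyOfIndexLE_one_holds`,
`SPC4OneHandlebodyBoundaryProofs.lean`) and the orientation-reversing `π₁`-trivial symmetry h₃
(`exists_diffeoExtends_isOrientationReversing_holds`, `SPC4HandlesOrientationReversingHolds.lean`)
are theorems.  With the uniqueness of attaching one `1`-handle **L1** now also a theorem
(`oneHandle_nonempty_diffeomorph_holds`, `OneHandleStepExists.lean`; Kosinski (1993), VI (6.6),
(11.4)(c)), this file records the exact residue:

* `nonempty_diffeomorph_of_hasHandleDecomposition_handleCount_one_holds` — **discharge of UNIQ₄**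
  (`nonempty_diffeomorph_of_hasHandleDecomposition_handleCount_one`,
  `SPC4HandlesModelReduction.lean`; Kosinski (1993), VI (11.4)(c), `m = 4`: two compact connected
  orientable `4`-manifolds with boundary with handle decompositions with one `0`-handle and `k`
  `1`-handles are diffeomorphic), by
  `nonempty_diffeomorph_of_hasHandleDecomposition_handleCount_one_of_oneHandle`
  (`SPC4HandlesLeaves.lean`) applied to `oneHandle_nonempty_diffeomorph_holds`.
* **h₂ is THMAᴹ in universe `0`** — this is §6 of `SPC4HandlesThmALift.lean`
  (`laudenbachPoenaru_diffeoExtends_of_isOrientationPreserving_of_oneHandlebody_zero`: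
  THMAᴹ`.{0}` → h₂`.{u}`; `…_of_zero`: h₂`.{0}` → h₂`.{u}`; `…_iff_oneHandlebody`); here the
  converse containments are added: the fact contains h₂
  (`laudenbachPoenaru_diffeoExtends_of_isOrientationPreserving_of_exists_diffeomorph_comp_incl_eq`,
  and `…_zero` into every universe) and THMAᴹ
  (`exists_oneHandlebody_laudenbachPoenaru_diffeoExtends_of_isOrientationPreserving_of_exists_diffeomorph_comp_incl_eq_zero`),
  and THMAᴹ`.{0}` already contains Cerf's `Γ₄ = 0`
  (`cerf_diffeomorph_sphere_three_extends_ball_of_thmA_zero`, through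
  `SPC4HandlesThmAImpliesCerf.lean`; for the fact itself this is the certificate of
  `SPC4HandlesImpliesCerf.lean`).
* **h₁ is Lemma 2 on one model per `p`**:
  `laudenbachPoenaru_exists_diffeoExtends_mapOfEq_eq_of_lemma2Model` (LEMMA2ᴹ → h₁),
  `…_of_realise` (REALISE → h₁: the paper's `H₁, H₂, H₃` on the model, Nielsen's theorem being
  proved) and `…_of_realisedGenerators` (any realised generating set of `Aut π₁` of the boundary
  of one model per `p`, `SPC4HandlesGeneratingSets.lean`).
* **The fact from two leaves**: `exists_diffeomorph_comp_incl_eq_of_lemma2_of_thmA`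
  (h₁`.{u}` + h₂`.{u}`), `exists_diffeomorph_comp_incl_eq_of_lemma2_of_thmA_zero`
  (h₁`.{u}` + h₂`.{0}`), `exists_diffeomorph_comp_incl_eq_of_two_leaves`
  (REALISE`.{u}` + THMAᴹ`.{0}`) and `exists_diffeomorph_comp_incl_eq_of_realisedGenerators_of_thmA_zero`.
  The discharge `exists_diffeomorph_comp_incl_eq_holds` is any of these applied to proofs of the
  two remaining leaves — Laudenbach–Poénaru's Lemma 2 on the model (handle slides realising
  `Aut F_p`, pp. 339–340) and the orientation-preserving `π₁`-trivial case of the proof of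
  Thm. A (Lemma 3, Laudenbach's isotopy theorem for systems of `2`-spheres in `#p S¹ × S²`,
  Ann. of Math. 97 (1973), §5, and Cerf's `Γ₄ = 0`; pp. 341–342) — once those land.

## References

* F. Laudenbach, V. Poénaru, *A note on 4-dimensional handlebodies*, Bull. Soc. Math. France
  100 (1972), 337–344: §2, Lemma 2 (pp. 339–340), Lemma 3 (p. 340), proof of Thm. A
  (pp. 341–342).  Held: `lit read doi-10-24033-bsmf-1741`. [LaudenbachPoenaruBSMF1972]
* F. Laudenbach, *Sur les 2-sphères d'une variété de dimension 3*, Ann. of Math. 97 (1973),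
  57–81, §5 (5.3–5.4). [Laudenbach1973]
* J. Cerf, *Sur les difféomorphismes de la sphère de dimension trois (Γ₄ = 0)*, LNM 53 (1968),
  Ch. I §1, Théorème 1, Corollaire 1. [Cerf1968]
* A. A. Kosinski, *Differential Manifolds*, Academic Press (1993), VI (6.6), §11, (11.4)(c).
  [Kosinski1993]
* R. C. Kirby, *The topology of 4-manifolds*, LNM 1374 (1989), Ch. I §2, p. 8. [Kirby1989]

## Design notes

* Only theorems are added; every proof is a composition of accepted reductions of the tree with
  the discharges `oneHandle_nonempty_diffeomorph_holds`,
  `exists_hasHandleDecomposition_handleCount_one_holds`,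
  `exists_diffeoExtends_isOrientationReversing_holds` and
  `exists_oneHandlebody_diffeoExtends_isOrientationReversing_holds`.
* Universes: the facts quantify over `V : Type u`; the model statements are needed in universe
  `0` only (the `ULift` bridges of `SPC4HandlesThmALift.lean` and `SPC4HandlesSymmHolds.lean`).
-/

open scoped Manifold ContDiff Topology
open Set Function

noncomputable section

namespace Literature.Topology.FourManifolds

universe u

/-! ### UNIQ₄ discharged -/

/-- **UNIQ₄, discharged: compact connected orientable smooth `4`-manifolds with boundary having
handle decompositions with one `0`-handle and `k` `1`-handles (same `k`) are diffeomorphic**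
(`nonempty_diffeomorph_of_hasHandleDecomposition_handleCount_one`; Kosinski, *Differential
Manifolds* (1993), VI (11.4)(c): "genus and orientability form a complete set of diffeomorphism
invariants" of `(m, 1)`-handlebodies, `m = 4`) — the tree's reduction to the uniqueness of
attaching one `1`-handle (`nonempty_diffeomorph_of_hasHandleDecomposition_handleCount_one_of_oneHandle`,
`SPC4HandlesLeaves.lean`) applied to its discharge `oneHandle_nonempty_diffeomorph_holds`
(`OneHandleStepExists.lean`). [cite: Kosinski1993, VI (6.6), (11.4)(c)] -/
theorem nonempty_diffeomorph_of_hasHandleDecomposition_handleCount_one_holds :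
    nonempty_diffeomorph_of_hasHandleDecomposition_handleCount_one.{u} :=
  nonempty_diffeomorph_of_hasHandleDecomposition_handleCount_one_of_oneHandle
    oneHandle_nonempty_diffeomorph_holds

/-! ### The fact contains h₂; h₂ is THMAᴹ in universe `0` (`SPC4HandlesThmALift.lean`, §6) -/

/-- **The extension fact contains its leaf h₂** (same universe): h₂ is the extension statement
under three extra hypotheses (orientation preservation, a fixed base point, triviality on `π₁`),
its conclusion `b.DiffeoExtends ψ` being the conclusion `∃ Φ, Φ ∘ incl = incl ∘ ψ` of
`exists_diffeomorph_comp_incl_eq` by definition. [cite: LaudenbachPoenaruBSMF1972, §2, proof of Thm. A, p. 342] -/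
theorem laudenbachPoenaru_diffeoExtends_of_isOrientationPreserving_of_exists_diffeomorph_comp_incl_eq
    (h : exists_diffeomorph_comp_incl_eq.{u}) :
    laudenbachPoenaru_diffeoExtends_of_isOrientationPreserving.{u} :=
  fun V _ _ _ _ _ _ _ hV ho b ψ _ _ _ _ => h V hV ho b ψ

/-- **Hence a universe-`0` discharge of the extension fact gives h₂ in every universe**
(`laudenbachPoenaru_diffeoExtends_of_isOrientationPreserving_of_oneHandle_of_zero`,
`SPC4HandlesThmALift.lean`, §5, with L1 discharged: a universe-`0` proof of h₂ lifts to every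
universe; cf. `…_of_zero`, §6 there). [cite: LaudenbachPoenaruBSMF1972, §2, proof of Thm. A, p. 342] -/
theorem laudenbachPoenaru_diffeoExtends_of_isOrientationPreserving_of_exists_diffeomorph_comp_incl_eq_zero
    (h : exists_diffeomorph_comp_incl_eq.{0}) :
    laudenbachPoenaru_diffeoExtends_of_isOrientationPreserving.{u} :=
  laudenbachPoenaru_diffeoExtends_of_isOrientationPreserving_of_oneHandle_of_zero
    oneHandle_nonempty_diffeomorph_holds
    (laudenbachPoenaru_diffeoExtends_of_isOrientationPreserving_of_exists_diffeomorph_comp_incl_eq h)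

/-- **And THMAᴹ in every universe** (`…_of_h₂` of `SPC4HandlesThmALift.lean`, §5: the models
`{q(x, y) + z² + w² ≤ c}` of `OneHandlebodySymmFour.lean` and their `ULift`s): the remaining leaf
THMAᴹ is not stronger than the fact it serves. [cite: LaudenbachPoenaruBSMF1972, §2, proof of Thm. A, p. 342] -/
theorem exists_oneHandlebody_laudenbachPoenaru_diffeoExtends_of_isOrientationPreserving_of_exists_diffeomorph_comp_incl_eq_zero
    (h : exists_diffeomorph_comp_incl_eq.{0}) :
    exists_oneHandlebody_laudenbachPoenaru_diffeoExtends_of_isOrientationPreserving.{u} :=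
  exists_oneHandlebody_laudenbachPoenaru_diffeoExtends_of_isOrientationPreserving_of_h₂
    (laudenbachPoenaru_diffeoExtends_of_isOrientationPreserving_of_exists_diffeomorph_comp_incl_eq h)

/-- **THMAᴹ in universe `0` already contains Cerf's `Γ₄ = 0`** (size certificate for the
remaining leaf): by `laudenbachPoenaru_diffeoExtends_of_isOrientationPreserving_of_two_leaves`
(`SPC4HandlesThmALift.lean`, §4, with `oneHandle_nonempty_diffeomorph_holds`) at universe `0` and
`cerf_diffeomorph_sphere_three_extends_ball_of_laudenbachPoenaru_diffeoExtends`
(`SPC4HandlesThmAImpliesCerf.lean`: h₂`.{0}` at `V = 𝔻⁴` is the statement that every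
self-diffeomorphism of `S³` extends over `D⁴`). [cite: LaudenbachPoenaruBSMF1972, §2, proof of Thm. A, pp. 341–342 (case p = 0)]
[cite: Cerf1968, Ch. I §1, Théorème 1 with Corollaire 1 (Γ₄ = 0)] -/
theorem cerf_diffeomorph_sphere_three_extends_ball_of_thmA_zero
    (hT : exists_oneHandlebody_laudenbachPoenaru_diffeoExtends_of_isOrientationPreserving.{0}) :
    cerf_diffeomorph_sphere_three_extends_ball :=
  cerf_diffeomorph_sphere_three_extends_ball_of_laudenbachPoenaru_diffeoExtends
    (laudenbachPoenaru_diffeoExtends_of_isOrientationPreserving_of_two_leaves.{0}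
      oneHandle_nonempty_diffeomorph_holds hT)

/-! ### h₁ is Lemma 2 on one model per `p` -/

/-- **h₁ from LEMMA2ᴹ alone**: Laudenbach–Poénaru's Lemma 2 for every compact connected
orientable `4`-dimensional `1`-handlebody (`laudenbachPoenaru_exists_diffeoExtends_mapOfEq_eq`:
every automorphism of `π₁(∂V, z₀)` is induced by an extendable based diffeomorphism) follows
from its model case, one model per `p`
(`exists_oneHandlebody_laudenbachPoenaru_exists_diffeoExtends_mapOfEq_eq`), NORM and UNIQ₄ being
discharged (`laudenbachPoenaru_exists_diffeoExtends_mapOfEq_eq_of_model`,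
`SPC4HandlesModelReduction.lean`). [cite: LaudenbachPoenaruBSMF1972, Lemma 2 (pp. 339–340)]
[cite: Kosinski1993, VI (11.4)(c)] -/
theorem laudenbachPoenaru_exists_diffeoExtends_mapOfEq_eq_of_lemma2Model
    (hL : exists_oneHandlebody_laudenbachPoenaru_exists_diffeoExtends_mapOfEq_eq.{u}) :
    laudenbachPoenaru_exists_diffeoExtends_mapOfEq_eq.{u} :=
  laudenbachPoenaru_exists_diffeoExtends_mapOfEq_eq_of_model
    exists_hasHandleDecomposition_handleCount_one_holds
    nonempty_diffeomorph_of_hasHandleDecomposition_handleCount_one_holds hL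

/-- **h₁ from REALISE alone**: it suffices to realise the paper's generators `Φ₁` (transpositions
of basis elements), `Φ₂ = (x₀ ↦ x₀⁻¹)`, `Φ₃ = (x₀ ↦ x₀x₁)` of `Aut F_p` by extendable based
diffeomorphisms of the boundary of one model per `p`
(`exists_oneHandlebody_realise_laudenbachPoenaruGenerators`; "it suffices to exhibit three
diffeomorphisms `Hᵢ` … such that `(Hᵢ)_# = Φᵢ`", p. 339), L1, NORM and Nielsen's theorem being
discharged (`laudenbachPoenaru_exists_diffeoExtends_mapOfEq_eq_of_oneHandle_of_realise`,
`SPC4HandlesNormHolds.lean`). [cite: LaudenbachPoenaruBSMF1972, §2, proof of Lemma 2 (pp. 339–340)] -/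
theorem laudenbachPoenaru_exists_diffeoExtends_mapOfEq_eq_of_realise
    (hR : exists_oneHandlebody_realise_laudenbachPoenaruGenerators.{u}) :
    laudenbachPoenaru_exists_diffeoExtends_mapOfEq_eq.{u} :=
  laudenbachPoenaru_exists_diffeoExtends_mapOfEq_eq_of_oneHandle_of_realise
    oneHandle_nonempty_diffeomorph_holds hR

/-- **h₁ from any realised generating set**: if for every `p` some compact connected orientable
smooth `4`-manifold with boundary with one `0`-handle and `p` `1`-handles, some boundary datum
and some base point carry a generating set of `Aut π₁` of the boundary each member of which is
induced by an extendable based diffeomorphism, then h₁ holds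
(`exists_oneHandlebody_laudenbachPoenaru_exists_diffeoExtends_mapOfEq_eq_of_generators`,
`SPC4HandlesGeneratingSets.lean`, then `…_of_lemma2Model`). [cite: LaudenbachPoenaruBSMF1972, §2, proof of Lemma 2 (p. 339)] -/
theorem laudenbachPoenaru_exists_diffeoExtends_mapOfEq_eq_of_realisedGenerators
    (hG : ∀ p : ℕ, ∃ (V₀ : Type u) (_ : TopologicalSpace V₀) (_ : T2Space V₀)
      (_ : SecondCountableTopology V₀) (_ : CompactSpace V₀) (_ : ConnectedSpace V₀)
      (_ : ChartedSpace (EuclideanHalfSpace 4) V₀) (_ : IsManifold (𝓡∂ 4) ∞ V₀)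
      (b₀ : BoundaryData (𝓡∂ 4) V₀ (𝓡 3)) (z₀ : b₀.carrier)
      (S : Set (MulAut (FundamentalGroup b₀.carrier z₀))),
      HasHandleDecomposition 3 V₀ (handleCount 1 p) ∧ IsOrientable (𝓡∂ 4) V₀ ∧
      Subgroup.closure S = ⊤ ∧ ∀ θ ∈ S, b₀.IsRealisedByExtendable z₀ θ) :
    laudenbachPoenaru_exists_diffeoExtends_mapOfEq_eq.{u} :=
  laudenbachPoenaru_exists_diffeoExtends_mapOfEq_eq_of_lemma2Model
    (exists_oneHandlebody_laudenbachPoenaru_exists_diffeoExtends_mapOfEq_eq_of_generators hG)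

/-! ### The fact from two leaves -/

/-- **Laudenbach–Poénaru's extension theorem from h₁ and h₂** (same universe): with h₃, h₄, h₅
discharged, the assembly `exists_diffeomorph_comp_incl_eq_of_laudenbachPoenaru''`
(`SPC4OneHandlebodyBoundaryProofs.lean`) needs only Lemma 2 (h₁) and the orientation-preserving
`π₁`-trivial case of the proof of Thm. A (h₂). [cite: LaudenbachPoenaruBSMF1972, §2, Lemma 2 and proof of Thm. A (pp. 339–342)] -/
theorem exists_diffeomorph_comp_incl_eq_of_lemma2_of_thmA
    (h₁ : laudenbachPoenaru_exists_diffeoExtends_mapOfEq_eq.{u})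
    (h₂ : laudenbachPoenaru_diffeoExtends_of_isOrientationPreserving.{u}) :
    exists_diffeomorph_comp_incl_eq.{u} :=
  exists_diffeomorph_comp_incl_eq_of_laudenbachPoenaru'' h₁ h₂
    exists_diffeoExtends_isOrientationReversing_holds

/-- **The same with h₂ taken in universe `0`**
(`laudenbachPoenaru_diffeoExtends_of_isOrientationPreserving_of_oneHandle_of_zero` with
`oneHandle_nonempty_diffeomorph_holds`).
[cite: LaudenbachPoenaruBSMF1972, §2, Lemma 2 and proof of Thm. A (pp. 339–342)] -/
theorem exists_diffeomorph_comp_incl_eq_of_lemma2_of_thmA_zero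
    (h₁ : laudenbachPoenaru_exists_diffeoExtends_mapOfEq_eq.{u})
    (h₂ : laudenbachPoenaru_diffeoExtends_of_isOrientationPreserving.{0}) :
    exists_diffeomorph_comp_incl_eq.{u} :=
  exists_diffeomorph_comp_incl_eq_of_lemma2_of_thmA h₁
    (laudenbachPoenaru_diffeoExtends_of_isOrientationPreserving_of_oneHandle_of_zero
      oneHandle_nonempty_diffeomorph_holds h₂)

/-- **Laudenbach–Poénaru's extension theorem from its two remaining leaves: REALISE and THMAᴹ in
universe `0`** — `exists_diffeomorph_comp_incl_eq_of_three_leaves_zero` (`SPC4HandlesThmALift.lean`)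
with L1 discharged.  The discharge `exists_diffeomorph_comp_incl_eq_holds` is this theorem applied
to proofs of the realisation of `H₁, H₂, H₃` on the model (Lemma 2, pp. 339–340) and of the
orientation-preserving `π₁`-trivial case of Thm. A on the model (pp. 341–342: Lemma 3,
Laudenbach (1973), §5, Cerf's `Γ₄ = 0`), once those land.
[cite: LaudenbachPoenaruBSMF1972, §2, Lemma 2 and proof of Thm. A (pp. 339–342)]
[cite: Kosinski1993, VI (6.6), (11.4)(c)] -/
theorem exists_diffeomorph_comp_incl_eq_of_two_leaves
    (hR : exists_oneHandlebody_realise_laudenbachPoenaruGenerators.{u})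
    (hA : exists_oneHandlebody_laudenbachPoenaru_diffeoExtends_of_isOrientationPreserving.{0}) :
    exists_diffeomorph_comp_incl_eq.{u} :=
  exists_diffeomorph_comp_incl_eq_of_three_leaves_zero oneHandle_nonempty_diffeomorph_holds hR hA

/-- **The fact from any realised generating set and THMAᴹ in universe `0`**
(`laudenbachPoenaru_exists_diffeoExtends_mapOfEq_eq_of_realisedGenerators` with
`exists_diffeomorph_comp_incl_eq_of_lemma2_of_thmA` and
`laudenbachPoenaru_diffeoExtends_of_isOrientationPreserving_of_two_leaves` with
`oneHandle_nonempty_diffeomorph_holds`).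
[cite: LaudenbachPoenaruBSMF1972, §2, Lemma 2 (p. 339) and proof of Thm. A (pp. 341–342)] -/
theorem exists_diffeomorph_comp_incl_eq_of_realisedGenerators_of_thmA_zero
    (hG : ∀ p : ℕ, ∃ (V₀ : Type u) (_ : TopologicalSpace V₀) (_ : T2Space V₀)
      (_ : SecondCountableTopology V₀) (_ : CompactSpace V₀) (_ : ConnectedSpace V₀)
      (_ : ChartedSpace (EuclideanHalfSpace 4) V₀) (_ : IsManifold (𝓡∂ 4) ∞ V₀)
      (b₀ : BoundaryData (𝓡∂ 4) V₀ (𝓡 3)) (z₀ : b₀.carrier)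
      (S : Set (MulAut (FundamentalGroup b₀.carrier z₀))),
      HasHandleDecomposition 3 V₀ (handleCount 1 p) ∧ IsOrientable (𝓡∂ 4) V₀ ∧
      Subgroup.closure S = ⊤ ∧ ∀ θ ∈ S, b₀.IsRealisedByExtendable z₀ θ)
    (hA : exists_oneHandlebody_laudenbachPoenaru_diffeoExtends_of_isOrientationPreserving.{0}) :
    exists_diffeomorph_comp_incl_eq.{u} :=
  exists_diffeomorph_comp_incl_eq_of_lemma2_of_thmA
    (laudenbachPoenaru_exists_diffeoExtends_mapOfEq_eq_of_realisedGenerators hG)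
    (laudenbachPoenaru_diffeoExtends_of_isOrientationPreserving_of_two_leaves
      oneHandle_nonempty_diffeomorph_holds hA)

end Literature.Topology.FourManifolds

end
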